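import Summits.SmoothPoincare4.SmoothPoincare4.Theorems.ConvexBisectionAcyclicBisectionExistsDualLinkAssembly
import HarnessLib

/-!
# Dual handles, T3c-3: the node from the universally quantified node statements T3c-1′, T3c-2
(sub-goal T3c-3 `node_dualLink_pageLink` of stub `stub_steinRealisation` (NF6), line
`modp-braid-orbits` r11, crux `ConvexBisection.AcyclicBisectionExists`, item stmt-SmoothPoincare4-10508;
wave 3, lead c5; registered sub-goal `helper_mfderiv_seamDiffeo`)

Sequel of `…DualLinkAssembly.lean` (`dualLink_pageLink_of_nodes`: node T3c-3 from the node statements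
T3c-1′, T3c-2 taken AT THE DATA).  Here the same with the node statements quantified exactly as in the
design file (`node_dualLink_pageLink_of_universal_nodes`), so that the lead's `node_dualLink_pageLink` is
`… NODE1 NODE2` for `NODE1 := node_belt_isotopic_pushoff` (V6-corrected) and `NODE2 := node_seam_transport`;
and the registered packaging `helper_mfderiv_seamDiffeo` of the two readings of the seam
(`coe_seamDiffeo`, `mfderiv_seamDiffeo`).

Everything is proved; no named facts, no `sorry`.

## References
* R. İ. Baykur, *Kähler decomposition of 4-manifolds*, AGT 6 (2006), proof of Thm. 5.1. [Baykur2006]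
* J. M. Lee, *Introduction to Smooth Manifolds* (2013), Thm. 5.11. [LeeSmoothManifolds2013]
-/

noncomputable section

-- the prescribed namespace `Summit.<P>.<Sub>.…` duplicates `SmoothPoincare4` (P = Sub)
set_option linter.dupNamespace false

open scoped Manifold ContDiff Topology

namespace Summit.SmoothPoincare4.SmoothPoincare4.Theorems.AcyclicBisectionExists.ModpBraidOrbits

open Set Function Filter Metric Topology Bundle
open Literature.Topology.FourManifolds Literature.Topology.FourManifolds.HandleAttachingMap
  Literature.Topology.FourManifolds.BoundaryManifold Literature.Topology.FourManifolds.LefschetzBase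
  Literature.Geometry.Symplectic

/-! ## §1 The two readings of the seam (registered packaging) -/

/-- **Sub-goal `helper_mfderiv_seamDiffeo` of stub `stub_steinRealisation`** (NF6 ▸ T3 ▸ T3c-3; wave 3,
lead c5): **the seam and its differential, in the two readings** — through `Ψ : bX.carrier ≅ bW.carrier`
and the restriction `R : ∂X ≅ bX.carrier` of the identity (the lifts `z = R y`, `u = dR(w)` of node
T3c-2), or through `seamDiffeo bX bW Ψ` on the canonical boundary carriers (the transport files):
`bW.incl (Ψ (R y)) = (seamDiffeo bX bW Ψ y : W)` and `d(bW.incl ∘ Ψ)_{R y}(dR_y w) =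
d(y ↦ (seamDiffeo bX bW Ψ y : W))_y (w)`. [cite: LeeSmoothManifolds2013, Thm. 5.11] -/
theorem helper_mfderiv_seamDiffeo : ∀ {X : Type} [TopologicalSpace X] [ChartedSpace (EuclideanHalfSpace 4) X] [IsManifold (𝓡∂ 4) ∞ X] {W : Type} [TopologicalSpace W] [ChartedSpace (EuclideanHalfSpace 4) W] [IsManifold (𝓡∂ 4) ∞ W] (bX : Literature.Topology.FourManifolds.BoundaryData (𝓡∂ 4) X (𝓡 3)) (bW : Literature.Topology.FourManifolds.BoundaryData (𝓡∂ 4) W (𝓡 3)) (Ψ : bX.carrier ≃ₘ⟮𝓡 3, 𝓡 3⟯ bW.carrier) (y : (Literature.Topology.FourManifolds.BoundaryManifold.boundaryData 3 X).carrier) (w : EuclideanSpace ℝ (Fin 3)), bW.incl (Ψ ((Literature.Topology.FourManifolds.BoundaryManifold.boundaryData 3 X).restrictDiffeomorph bX (Diffeomorph.refl (𝓡∂ 4) X ∞) y)) = (Literature.Topology.FourManifolds.BoundaryManifold.boundaryData 3 W).incl (Summit.SmoothPoincare4.SmoothPoincare4.Theorems.AcyclicBisectionExists.ModpBraidOrbits.seamDiffeo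 bX bW Ψ y) ∧ mfderiv (𝓡 3) (𝓡∂ 4) (fun y => bW.incl (Ψ y)) ((Literature.Topology.FourManifolds.BoundaryManifold.boundaryData 3 X).restrictDiffeomorph bX (Diffeomorph.refl (𝓡∂ 4) X ∞) y) (mfderiv (𝓡 3) (𝓡 3) ((Literature.Topology.FourManifolds.BoundaryManifold.boundaryData 3 X).restrictDiffeomorph bX (Diffeomorph.refl (𝓡∂ 4) X ∞)) y w) = mfderiv (𝓡 3) (𝓡∂ 4) (fun y => (Literature.Topology.FourManifolds.BoundaryManifold.boundaryData 3 W).incl (Summit.SmoothPoincare4.SmoothPoincare4.Theorems.AcyclicBisectionExists.ModpBraidOrbits.seamDiffeo bX bW Ψ y)) y w :=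
  fun bX bW Ψ y w => ⟨(coe_seamDiffeo bX bW Ψ y).symm, mfderiv_seamDiffeo bX bW Ψ y w⟩

/-! ## §2 Node T3c-3 from the universally quantified node statements -/

/-- **Node T3c-3 from the ∀-quantified node statements, verbatim.**  `NODE1` = the statement of
`node_belt_isotopic_pushoff` (design file `T3_DualHandles_Design.lean` l. 501–522) with V6's corrected
shadow clause `shadow = (l.get j).1 ∨ shadow = -(l.get j).1`; `NODE2` = the statement of
`node_seam_transport` (l. 544–575, its `PageClause` inlined); conclusion: node T3c-3 in the form consumed
by the NF6 assembly (clause (i) of `node_T3_dualPresentation` + the `IsMultiAttachment` transfer), for the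
data of `node_dualLink_pageLink` plus the sign hypotheses on `N`.  One line over
`dualLink_pageLink_of_nodes`. [cite: Baykur2006, Thm. 5.1 (proof, p. 13)] -/
theorem node_dualLink_pageLink_of_universal_nodes
    (NODE1 : ∀ (g : ℕ) (l : List ((Fin g ⊕ Fin g → ℤ) × Bool))
      (h : Fin l.length → HandleAttachingMap 3 2 (Base g)) (hlink : IsLefschetzLink g l h)
      {X : Type} [TopologicalSpace X] [T2Space X] [SecondCountableTopology X] [CompactSpace X]
      [ChartedSpace (EuclideanHalfSpace 4) X] [IsManifold (𝓡∂ 4) ∞ X]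
      (D : MultiAttachmentData h (𝓡∂ 4) X) (η : ℝ) (hη : 0 < η) (hηπ : η * l.length < Real.pi),
      ∃ (σ₀ : ℤ) (K : Fin l.length → sphere (0 : EuclideanSpace ℝ (Fin 2)) 1 → Base g)
        (ν : Fin l.length → sphere (0 : EuclideanSpace ℝ (Fin 2)) 1 → EuclideanSpace ℝ (Fin 4))
        (hKc : ∀ j, Continuous (K j)) (hK : ∀ j θ, K j θ ∈ coresComplement h)
        (Φ : LinkIsotopyInBoundary (fun j => (beltMap D j).attachingCircle)
          (fun j θ => D.jA ⟨K j θ, hK j θ⟩))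
        (νt : Fin l.length → ℝ → sphere (0 : EuclideanSpace ℝ (Fin 2)) 1 → EuclideanSpace ℝ (Fin 4)),
        (σ₀ = 1 ∨ σ₀ = -1) ∧
        (∀ (j : Fin l.length) θ,
          K j θ ∈ page g (pageDir l.length j * Complex.exp (-(η : ℂ) * Complex.I))) ∧
        (∀ j, IsBoundaryKnot (K j)) ∧ (∀ j, IsKnotFraming (K j) (ν j)) ∧
        (∀ j, shadow g (K j) (hKc j) = (l.get j).1 ∨ shadow g (K j) (hKc j) = -(l.get j).1) ∧
        (∀ j, pageTwisting g (K j) (ν j) = σ₀ * (if (l.get j).2 then -1 else 1)) ∧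
        (∀ j, IsFramingAlong (Φ.isotopy j) (beltMap D j).attachingFraming (νt j)) ∧
        (∀ j, FramingHomotopic (fun θ => D.jA ⟨K j θ, hK j θ⟩) (νt j 1)
          (fun θ => mfderiv (𝓡∂ 4) (𝓡∂ 4) (fun a : ↥(coresComplement h) => D.jA a)
            ⟨K j θ, hK j θ⟩ (ν j θ))))
    (NODE2 : ∀ (g : ℕ) (l : List ((Fin g ⊕ Fin g → ℤ) × Bool))
      (h : Fin l.length → HandleAttachingMap 3 2 (Base g)) (hlink : IsLefschetzLink g l h)
      {X : Type} [TopologicalSpace X] [T2Space X] [SecondCountableTopology X] [CompactSpace X]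
      [ChartedSpace (EuclideanHalfSpace 4) X] [IsManifold (𝓡∂ 4) ∞ X]
      (D : MultiAttachmentData h (𝓡∂ 4) X) (bX : BoundaryData (𝓡∂ 4) X (𝓡 3))
      (Ψ : bX.carrier ≃ₘ⟮𝓡 3, 𝓡 3⟯ (bBase g).carrier)
      (hpage : ∀ (y : bX.carrier) (a : ↥(coresComplement h)), bX.incl y = D.jA a →
        ∃ c : ℝ, 0 < c ∧ w g ((bBase g).incl (Ψ y)).1 = (c : ℂ) * w g (a : Base g).1),
      ∃ s₀ : ℤ, (s₀ = 1 ∨ s₀ = -1) ∧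
        ∀ (ι : Type) [Finite ι] (c : ι → ℂ) (_ : ∀ i, ‖c i‖ = 1) (_ : Injective c)
          (K : ι → sphere (0 : EuclideanSpace ℝ (Fin 2)) 1 → Base g)
          (ν : ι → sphere (0 : EuclideanSpace ℝ (Fin 2)) 1 → EuclideanSpace ℝ (Fin 4))
          (hKc : ∀ i, Continuous (K i)) (hK : ∀ i θ, K i θ ∈ coresComplement h)
          (_ : ∀ i θ, K i θ ∈ page g (c i)) (_ : ∀ i, IsBoundaryKnot (K i))
          (_ : ∀ i, IsKnotFraming (K i) (ν i))
          (z : ι → sphere (0 : EuclideanSpace ℝ (Fin 2)) 1 → bX.carrier)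
          (_ : ∀ i θ, bX.incl (z i θ) = D.jA ⟨K i θ, hK i θ⟩)
          (u : ι → sphere (0 : EuclideanSpace ℝ (Fin 2)) 1 → EuclideanSpace ℝ (Fin 3))
          (_ : ∀ i θ, mfderiv (𝓡 3) (𝓡∂ 4) bX.incl (z i θ) (u i θ) =
            mfderiv (𝓡∂ 4) (𝓡∂ 4) (fun a : ↥(coresComplement h) => D.jA a) ⟨K i θ, hK i θ⟩ (ν i θ)),
          ∃ (A : ι → ((Fin g ⊕ Fin g → ℤ) ≃ₗ[ℤ] (Fin g ⊕ Fin g → ℤ)))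
            (K' : ι → sphere (0 : EuclideanSpace ℝ (Fin 2)) 1 → Base g)
            (ν' : ι → sphere (0 : EuclideanSpace ℝ (Fin 2)) 1 → EuclideanSpace ℝ (Fin 4))
            (hK'c : ∀ i, Continuous (K' i))
            (Φ : LinkIsotopyInBoundary (fun i θ => ((bBase g).incl (Ψ (z i θ)) : Base g)) K')
            (νt : ι → ℝ → sphere (0 : EuclideanSpace ℝ (Fin 2)) 1 → EuclideanSpace ℝ (Fin 4)),
            (∀ i θ, K' i θ ∈ page g (c i)) ∧ (∀ i, IsKnotFraming (K' i) (ν' i)) ∧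
            (∀ i, shadow g (K' i) (hK'c i) = A i (shadow g (K i) (hKc i))) ∧
            (∀ i, pageTwisting g (K' i) (ν' i) = s₀ * pageTwisting g (K i) (ν i)) ∧
            (∀ i, IsFramingAlong (Φ.isotopy i)
              (fun θ => mfderiv (𝓡 3) (𝓡∂ 4) (fun y => ((bBase g).incl (Ψ y) : Base g)) (z i θ) (u i θ))
              (νt i)) ∧
            (∀ i, FramingHomotopic (K' i) (νt i 1) (ν' i)))
    (g : ℕ) (P N : List ((Fin g ⊕ Fin g → ℤ) × Bool))
    (h : Fin (P ++ N).length → HandleAttachingMap 3 2 (Base g)) (hlink : IsLefschetzLink g (P ++ N) h)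
    {X : Type} [TopologicalSpace X] [T2Space X] [SecondCountableTopology X] [CompactSpace X]
    [ChartedSpace (EuclideanHalfSpace 4) X] [IsManifold (𝓡∂ 4) ∞ X]
    (D : MultiAttachmentData h (𝓡∂ 4) X) (bX : BoundaryData (𝓡∂ 4) X (𝓡 3))
    (Ψ : bX.carrier ≃ₘ⟮𝓡 3, 𝓡 3⟯ (bBase g).carrier)
    (hpage : ∀ (y : bX.carrier) (a : ↥(coresComplement h)), bX.incl y = D.jA a →
      ∃ c : ℝ, 0 < c ∧ w g ((bBase g).incl (Ψ y)).1 = (c : ℂ) * w g (a : Base g).1)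
    (col : (BoundaryManifold.boundaryData 3 (Base g)).Collar) (κ δ : ℝ) (hκ : 0 < κ) (hκ1 : κ ≤ 1)
    (hδ : 0 < δ) (hδ2 : δ ≤ 1 / 2) (hN0 : ∀ x ∈ N, x.1 ≠ 0) (hNs : ∀ x ∈ N, x.2 = false) :
    ∃ (s : Bool) (h' : Fin N.length → HandleAttachingMap 3 2 (Base g)),
      (∀ j, ∃ c : ℂ, ‖c‖ = 1 ∧ ∀ θ, (h' j).attachingCircle θ ∈ page g c) ∧
      (∀ j, shadow g (h' j).attachingCircle (h' j).continuous_attachingCircle ≠ 0) ∧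
      (∀ j, pageTwisting g (h' j).attachingCircle (h' j).attachingFraming = if s then -1 else 1) ∧
      (Pairwise fun i j => Disjoint (range (h' i).toFun) (range (h' j).toFun)) ∧
      ∀ (W₂ : Type) [TopologicalSpace W₂] [ChartedSpace (EuclideanHalfSpace 4) W₂] [IsManifold (𝓡∂ 4) ∞ W₂],
        HandleAttachingMap.IsMultiAttachment
          (fun j : Fin N.length => dualMap D bX (bBase g) Ψ col κ δ hκ hκ1 hδ hδ2
            (Fin.cast List.length_append.symm (Fin.natAdd P.length j))) (𝓡∂ 4) W₂ →
        HandleAttachingMap.IsMultiAttachment h' (𝓡∂ 4) W₂ :=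
  dualLink_pageLink_of_nodes g P N h D bX Ψ col κ δ hκ hκ1 hδ hδ2 hN0 hNs
    (fun η hη hηπ => NODE1 g (P ++ N) h hlink D η hη hηπ) (NODE2 g (P ++ N) h hlink D bX Ψ hpage)

end Summit.SmoothPoincare4.SmoothPoincare4.Theorems.AcyclicBisectionExists.ModpBraidOrbits

end
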